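import Mathlib
import Summits.NavierStokesRegularity.NavierStokesRegularity.Theorems.FilamentSkeletonRssStadiumCornerRightFoot

/-!
# Route `FilamentSkeletonRss` · child crux `TangentSkeletonNearStraightL` (stmt-NavierStokesRegularity-23320) · registered line
# `child_tangent_analytic_strip_L` (b0b56c52900dd90a), stub `stub_stripPropagation` — assembly: QUANTITATIVE MARGIN OF THE REAL-AXIS FOOT SOURCES

Gap form of `Theorems.StadiumCornerRightFoot.corner_right_foot_re_pos` for the bound / far-tail step of the retyped blueprint: for a target
`z = x₀ + iY` of the right output corner region and a real source `X(x₀ + D)`, `D ≥ hs/2`: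
`((7/8)D − 0.0398hs)² − (hs/4 + 0.0389hs)² ≤ Re Σᵢ (Fᵢ(z) − X(x₀+D)ᵢ)²` (`corner_right_foot_re_ge`) — quadratic growth in `D`, `≥ 0.074hs²`.
HONEST FRAMING: bookkeeping for a HYPOTHETICAL filament skeleton on the NEGATIVE side of a MODEL route; the stub `stub_stripPropagation` is NOT
closed by this file; nothing here bears on Navier–Stokes regularity or blow-up.  `--supports stmt-NavierStokesRegularity-23320`.
-/

set_option linter.dupNamespace false

noncomputable section

namespace Summit.NavierStokesRegularity.NavierStokesRegularity.Theorems.StadiumCornerQuantFoot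

open Set MeasureTheory
open scoped InnerProductSpace BigOperators
open Summit.NavierStokesRegularity.NavierStokesRegularity.Theorems.StadiumFootBare
open Summit.NavierStokesRegularity.NavierStokesRegularity.Theorems.StadiumChordProjection
open Summit.NavierStokesRegularity.NavierStokesRegularity.Theorems.StadiumLogBounds
open Summit.NavierStokesRegularity.NavierStokesRegularity.Theorems.StadiumLegProfiles
open Summit.NavierStokesRegularity.NavierStokesRegularity.Theorems.StadiumCornerRightFoot

/-- **The real-axis foot sources of the right corner, quantitative.**  Stadium `S = {|Im| < hs, |Re − cc| < L + hs}`, `F` holomorphic on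
`S` with `‖F′‖ ≤ 2`, `Σ (F′)ᵢ² = 1`, `F = cplx ∘ X` on the real trace, `X` of class `C¹` with unit speed and tangent oscillation
`≤ Rb ≤ 1/2`; a target `z = x₀ + iY` of the right output corner region (`0 ≤ Y < hs/4`, `cc ≤ x₀ < cc + L + hs/4`) and a REAL source
`X(x₀ + D)` with `D ≥ hs/2` (anywhere on the real axis to the right of the foot of the descent); QUANTITATIVE form (for the bound / far-tail step):
`((7/8)D − 0.0398hs)² − (hs/4 + 0.0389hs)² ≤ Re Σᵢ (Fᵢ(z) − X(x₀+D)ᵢ)²` (`≥ 0.074·hs²` at `D = hs/2`, `∼ (7D/8)²` far out). [folklore] -/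
theorem corner_right_foot_re_ge {hs L cc : ℝ} {F : ℂ → (Fin 3 → ℂ)}
    (hF : DifferentiableOn ℂ F {z : ℂ | |z.im| < hs ∧ |z.re - cc| < L + hs})
    (hM : ∀ z ∈ {z : ℂ | |z.im| < hs ∧ |z.re - cc| < L + hs}, ‖deriv F z‖ ≤ 2)
    (hunit : ∀ w ∈ {z : ℂ | |z.im| < hs ∧ |z.re - cc| < L + hs}, ∑ i, (deriv F w i) ^ 2 = 1)
    {X : ℝ → EuclideanSpace ℝ (Fin 3)} (hX : ContDiff ℝ 1 X) (hXu : ∀ τ, ‖deriv X τ‖ = 1)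
    {Rb : ℝ} (hRb0 : 0 ≤ Rb) (hRb : Rb ≤ 1 / 2) (hosc : ∀ τ σ, ‖deriv X τ - deriv X σ‖ ≤ Rb)
    (hFX : ∀ r : ℝ, (r : ℂ) ∈ {z : ℂ | |z.im| < hs ∧ |z.re - cc| < L + hs} →
      F r = fun i => ((⟪X r, EuclideanSpace.single i (1:ℝ)⟫_ℝ : ℝ) : ℂ))
    (hhs : 0 < hs) {x₀ Y D : ℝ} (hY0 : 0 ≤ Y) (hY : Y < hs / 4) (hx₀ : x₀ < cc + L + hs / 4) (hx₀cc : cc ≤ x₀)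
    (hD : hs / 2 ≤ D) :
    (7 / 8 * D - 0.0398 * hs) ^ 2 - (hs / 4 + 0.0389 * hs) ^ 2 ≤
      (∑ i, (F ((x₀ : ℂ) + (Y : ℂ) * Complex.I) i - ((⟪X (x₀ + D), EuclideanSpace.single i (1:ℝ)⟫_ℝ : ℝ) : ℂ)) ^ 2).re := by
  have hXd : Differentiable ℝ X := hX.differentiable (by norm_num)
  -- the target leg radius `R₁ = 3hs/4`
  have hR₁Y : Y < 3 * hs / 4 := by linarith
  have hR₁hs : 3 * hs / 4 < hs := by linarith
  have hR₁end : |x₀ - cc| + 3 * hs / 4 < L + hs := by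
    rw [abs_of_nonneg (by linarith)]; linarith
  -- the chord projection `c₀ = (1 − Rb²/2)·D ≥ 7hs/16`
  have hc₀ := chord_proj_coords_ge hX hXu hosc (x₁ := x₀) (x₂ := x₀ + D) (by linarith)
  have hc₀' : 7 / 16 * hs ≤ (1 - Rb ^ 2 / 2) * (x₀ + D - x₀) := by
    have e : x₀ + D - x₀ = D := by ring
    rw [e]
    have h1 : 7 / 8 ≤ 1 - Rb ^ 2 / 2 := by nlinarith
    nlinarith
  -- the numbers
  have hI := corner_I_le hhs hY0 hY.le
  have hJ := corner_J_le hhs hY0 hY.le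
  have hI0 : 0 ≤ √3 * (2 * 2 * (Y - (3 * hs / 4 - Y) * Real.log (3 * hs / 4 / (3 * hs / 4 - Y)) - Y ^ 2 / (2 * (3 * hs / 4)))) := by
    have h := legI_closed_mono (M := 2) (R := 3 * hs / 4) (t₁ := 0) (t₂ := Y) (by norm_num) le_rfl hY0 hR₁Y
    have e : √3 * (2 * 2 * (0 - (3 * hs / 4 - 0) * Real.log (3 * hs / 4 / (3 * hs / 4 - 0)) - 0 ^ 2 / (2 * (3 * hs / 4)))) = 0 := by
      rw [sub_zero, div_self (by positivity : (3 * hs / 4) ≠ 0), Real.log_one]; ring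
    rw [e] at h
    exact h
  -- atomise the three closed forms
  generalize hCv : (1 - Rb ^ 2 / 2) * (x₀ + D - x₀) = Cv at hc₀ hc₀'
  generalize hJv : 6 * (2:ℝ) ^ 2 * (2 * Y - (3 * hs / 4 - Y) * Real.log (3 * hs / 4 / (3 * hs / 4 - Y)) ^ 2 -
        2 * (3 * hs / 4 - Y) * Real.log (3 * hs / 4 / (3 * hs / 4 - Y)) +
        ((3 * hs / 4) ^ 2 - Y ^ 2) * Real.log (3 * hs / 4 / (3 * hs / 4 - Y)) / (2 * (3 * hs / 4)) - Y / 2 -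
        Y ^ 2 / (4 * (3 * hs / 4))) = Jv at hJ
  generalize hIv : √3 * (2 * 2 * (Y - (3 * hs / 4 - Y) * Real.log (3 * hs / 4 / (3 * hs / 4 - Y)) -
      Y ^ 2 / (2 * (3 * hs / 4)))) = Iv at hI hI0
  have ha' : 0 ≤ Cv - Jv := by linarith
  have h := bare_foot_re_ge_closed_form (M := 2) hF hM hunit hXd hXu hosc hFX hhs hY0 hR₁Y hR₁hs hR₁end hc₀
    (by rw [hJv]; exact ha')
  rw [hJv, hIv] at h
  -- difference of squares, quantitative
  have hB0 : 0 ≤ Y + Iv := by linarith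
  have hBle : Y + Iv ≤ hs / 4 + 0.0389 * hs := by linarith
  have hAge : 7 / 8 * D - 0.0398 * hs ≤ Cv - Jv := by
    have e : x₀ + D - x₀ = D := by ring
    have hC : (1 - Rb ^ 2 / 2) * D ≤ Cv := by rw [← e]; exact le_of_eq hCv
    have h78 : 7 / 8 * D ≤ (1 - Rb ^ 2 / 2) * D := by
      have h1 : 7 / 8 ≤ 1 - Rb ^ 2 / 2 := by nlinarith
      exact mul_le_mul_of_nonneg_right h1 (by linarith)
    linarith
  have hA0 : 0 ≤ 7 / 8 * D - 0.0398 * hs := by linarith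
  have h1 : (7 / 8 * D - 0.0398 * hs) ^ 2 ≤ (Cv - Jv) ^ 2 := pow_le_pow_left₀ hA0 hAge 2
  have h2 : (Y + Iv) ^ 2 ≤ (hs / 4 + 0.0389 * hs) ^ 2 := pow_le_pow_left₀ hB0 hBle 2
  linarith

end Summit.NavierStokesRegularity.NavierStokesRegularity.Theorems.StadiumCornerQuantFoot

end
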